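import Literature.AnabelianGeometry.SemiGraphs.ProSigmaCompletionSemidirectCofinal
import Mathlib.GroupTheory.OrderOfElement
import HarnessLib

/-!
# Pro-`Σ` completions, VI: a Dehn-twist-shaped automorphism has `Σ`-power order on `Σ`-quotients

Part V (`ProSigmaCompletionSemidirectCofinal.lean`, `SemidirectCofinal.isProSigmaCompletion_closure_inl`)
shows that `ι ∘ inl : Δ → closure ι(inl Δ)` is a pro-`Σ` completion of the fibre of `Δ ⋊_φ ℤ` as soon as the
twist `τ = φ(1)` satisfies: for every normal `N ⊴ Δ` of `Σ`-integer index some `Σ`-integer power `τ^m` is the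
identity modulo `N`.  Here that hypothesis is DISCHARGED for the shape of a Dehn twist along one node of a
semi-graph of groups ([AbsTopII] Def. 1.2 (ii); [SemiAnbd] Ex. 2.10): `τ` is the identity on a subgroup `A`,
conjugation by a `τ`-fixed element `c` on a subgroup `B`, and `A ⊔ B = Δ` (for `Γ_{0,4} = F₂ *_{⟨c⟩} F₂` twisted
along the edge `⟨c⟩`).  Then `τ^{[Δ:N]} ≡ id (mod N)` for EVERY normal `N` (as `c^{[Δ:N]} ∈ N`), and `[Δ:N]` is
the required `Σ`-integer.

* `SemidirectCofinal.twist_pow_index_trivial_mod` — `τ^{[Δ:N]}(x)·x⁻¹ ∈ N` for all `x`;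
* `SemidirectCofinal.twist_sigma_power_of_partialConj` — the hypothesis `hφ` of part V for such `φ`;
* `SemidirectCofinal.isProSigmaCompletion_closure_inl_of_partialConj` — hence `ι ∘ inl` is a pro-`Σ`
  completion of `Δ` for every pro-`Σ` completion `ι` of `Δ ⋊_φ ℤ` with profinite target.
Plain group theory; theorems only (iteration bookkeeping is `private`); no side taken on [IUTchIII] Cor. 3.12.
[cite: MochizukiSemiAnbd2006, Ex. 2.10 p.31]
-/

namespace Literature.AnabelianGeometry.SemiGraphs.SemiGraphOfAnabelioids.IsProSigmaCompletion

open Literature.AnabelianGeometry.Anabelioids Topology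

namespace SemidirectCofinal

variable {Δ : Type*} [Group Δ] {Sigma : Set ℕ}

/-- Powers of `τ` fix what `τ` fixes. [folklore] -/
private theorem pow_apply_of_fixed (τ : MulAut Δ) {a : Δ} (ha : τ a = a) (k : ℕ) : (τ ^ k) a = a := by
  induction k with
  | zero => simp
  | succ k ih => rw [pow_succ', MulAut.mul_apply, ih, ha]

/-- Powers of a partial conjugation: `τ^k b = c^k b c^{-k}` when `τ b = c b c⁻¹` and `τ c = c`. [folklore] -/
private theorem pow_apply_of_conj (τ : MulAut Δ) (c : Δ) (hc : τ c = c) {b : Δ} (hb : τ b = c * b * c⁻¹)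
    (k : ℕ) : (τ ^ k) b = c ^ k * b * (c ^ k)⁻¹ := by
  induction k with
  | zero => simp
  | succ k ih =>
    rw [pow_succ', MulAut.mul_apply, ih, map_mul, map_mul, map_inv, map_pow, hc, hb, pow_succ, mul_inv_rev]
    simp only [mul_assoc]

/-- **A Dehn-twist-shaped automorphism is unipotent on finite quotients.**  If `τ ∈ Aut(Δ)` is the identity on
`A`, conjugation by a `τ`-fixed element `c` on `B`, and `A ⊔ B = ⊤`, then `τ^{[Δ:N]} ≡ id (mod N)` for every
normal subgroup `N` (the set where this holds is a subgroup containing `A` and, since `c^{[Δ:N]} ∈ N`, `B`).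
[cite: MochizukiSemiAnbd2006, Ex. 2.10 p.31] -/
theorem twist_pow_index_trivial_mod (τ : MulAut Δ) (A B : Subgroup Δ) (hAB : A ⊔ B = ⊤) (c : Δ) (hc : τ c = c)
    (hA : ∀ a ∈ A, τ a = a) (hB : ∀ b ∈ B, τ b = c * b * c⁻¹) (N : Subgroup Δ) [hNn : N.Normal] (x : Δ) :
    (τ ^ N.index) x * x⁻¹ ∈ N := by
  -- the locus `{x | τ^m x · x⁻¹ ∈ N}` is a subgroup (as `N` is normal) ...
  let S : Subgroup Δ :=
    { carrier := {y | (τ ^ N.index) y * y⁻¹ ∈ N}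
      mul_mem' := by
        intro y z hy hz
        have e : (τ ^ N.index) (y * z) * (y * z)⁻¹ =
            ((τ ^ N.index) y * y⁻¹) * (y * ((τ ^ N.index) z * z⁻¹) * y⁻¹) := by
          rw [map_mul]
          group
        show (τ ^ N.index) (y * z) * (y * z)⁻¹ ∈ N
        rw [e]
        exact N.mul_mem hy (hNn.conj_mem _ hz y)
      one_mem' := by
        show (τ ^ N.index) 1 * 1⁻¹ ∈ N
        rw [map_one, inv_one, mul_one]
        exact N.one_mem
      inv_mem' := by
        intro y hy
        have e : (τ ^ N.index) y⁻¹ * y⁻¹⁻¹ = y⁻¹ * ((τ ^ N.index) y * y⁻¹)⁻¹ * y⁻¹⁻¹ := by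
          rw [map_inv]
          group
        show (τ ^ N.index) y⁻¹ * y⁻¹⁻¹ ∈ N
        rw [e]
        exact hNn.conj_mem _ (N.inv_mem hy) y⁻¹ }
  -- ... containing `A` ...
  have hAS : A ≤ S := fun a ha => by
    show (τ ^ N.index) a * a⁻¹ ∈ N
    rw [pow_apply_of_fixed τ (hA a ha), mul_inv_cancel]
    exact N.one_mem
  -- ... and `B`, because `c ^ [Δ:N] ∈ N`
  have hBS : B ≤ S := fun b hb => by
    show (τ ^ N.index) b * b⁻¹ ∈ N
    rw [pow_apply_of_conj τ c hc (hB b hb)]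
    have e : c ^ N.index * b * (c ^ N.index)⁻¹ * b⁻¹ = c ^ N.index * (b * (c ^ N.index)⁻¹ * b⁻¹) := by group
    rw [e]
    exact N.mul_mem (N.pow_index_mem c) (hNn.conj_mem _ (N.inv_mem (N.pow_index_mem c)) b)
  have hS : S = ⊤ := top_le_iff.mp (hAB ▸ sup_le hAS hBS)
  have hx : x ∈ S := hS ▸ Subgroup.mem_top x
  exact hx

/-- The hypothesis `hφ` of `SemidirectCofinal.exists_normal_sigma_trace` / `isProSigmaCompletion_closure_inl` for
a Dehn-twist-shaped `φ(1)`: `m = [Δ:N]` works. [cite: MochizukiSemiAnbd2006, Ex. 2.10 p.31] -/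
theorem twist_sigma_power_of_partialConj (φ : Multiplicative ℤ →* MulAut Δ) (A B : Subgroup Δ) (hAB : A ⊔ B = ⊤)
    (c : Δ) (hc : φ (Multiplicative.ofAdd 1) c = c) (hA : ∀ a ∈ A, φ (Multiplicative.ofAdd 1) a = a)
    (hB : ∀ b ∈ B, φ (Multiplicative.ofAdd 1) b = c * b * c⁻¹)
    (N : Subgroup Δ) (hNn : N.Normal) (hN : IsSigmaInteger Sigma N.index) :
    ∃ m : ℕ, IsSigmaInteger Sigma m ∧ ∀ x, (φ (Multiplicative.ofAdd (m : ℤ))) x * x⁻¹ ∈ N := by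
  refine ⟨N.index, hN, fun x => ?_⟩
  have e : φ (Multiplicative.ofAdd (N.index : ℤ)) = φ (Multiplicative.ofAdd 1) ^ N.index := by
    rw [← map_pow, ← ofAdd_nsmul, nsmul_eq_mul, mul_one]
  rw [e]
  exact twist_pow_index_trivial_mod _ A B hAB c hc hA hB N x

variable {P : Type*} [Group P] [TopologicalSpace P] [IsTopologicalGroup P] [CompactSpace P]
  [TotallyDisconnectedSpace P]

/-- **The fibre of a Dehn-twist extension is pro-`Σ` completed by closure.**  For `φ : ℤ → Aut(Δ)` with `φ(1)`
the identity on `A`, conjugation by a `φ(1)`-fixed `c` on `B`, `A ⊔ B = ⊤`, and any pro-`Σ` completion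
`ι : Δ ⋊_φ ℤ → P` with profinite target, `ι ∘ inl : Δ → closure ι(inl Δ)` is a pro-`Σ` completion of `Δ`.
[cite: MochizukiSemiAnbd2006, Ex. 2.10 p.31] -/
theorem isProSigmaCompletion_closure_inl_of_partialConj {φ : Multiplicative ℤ →* MulAut Δ}
    {ι : (Δ ⋊[φ] Multiplicative ℤ) →* P} (hι : IsProSigmaCompletion Sigma ι) (A B : Subgroup Δ)
    (hAB : A ⊔ B = ⊤) (c : Δ) (hc : φ (Multiplicative.ofAdd 1) c = c)
    (hA : ∀ a ∈ A, φ (Multiplicative.ofAdd 1) a = a) (hB : ∀ b ∈ B, φ (Multiplicative.ofAdd 1) b = c * b * c⁻¹) :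
    IsProSigmaCompletion Sigma
      (((Subgroup.inclusion (Subgroup.le_topologicalClosure
        ((SemidirectProduct.inl : Δ →* Δ ⋊[φ] Multiplicative ℤ).range.map ι))).comp
        (ι.subgroupMap (SemidirectProduct.inl : Δ →* Δ ⋊[φ] Multiplicative ℤ).range)).comp
        (MonoidHom.ofInjective (SemidirectProduct.inl_injective (φ := φ))).toMonoidHom) :=
  isProSigmaCompletion_closure_inl φ hι (twist_sigma_power_of_partialConj φ A B hAB c hc hA hB)

end SemidirectCofinal

end Literature.AnabelianGeometry.SemiGraphs.SemiGraphOfAnabelioids.IsProSigmaCompletion
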